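import Summits.BirchSwinnertonDyer.BirchSwinnertonDyer.Theses.ShaPrimaryTransfer
import Summits.BirchSwinnertonDyer.BirchSwinnertonDyer.Theses.Squeeze
import Summits.BirchSwinnertonDyer.BirchSwinnertonDyer.Theorems.ShaPrimaryTransferFiniteShaComponentTransferSlices
import Summits.BirchSwinnertonDyer.BirchSwinnertonDyer.Theorems.ShaPrimaryTransferAssemblyWeakTransfer
import Summits.BirchSwinnertonDyer.BirchSwinnertonDyer.Theorems.CongruentShaFreeCutShaPrimaryTransfer

/-!
# BirchSwinnertonDyer / ShaPrimaryTransfer — crux `FiniteShaComponentTransfer` (stmt-BirchSwinnertonDyer-22356):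
# repair census — Selmer coordinates, the parity repairs, and the rank-one cell at the door prime 2
# is a registered crux (`CongruentShaFreeCut.AnalyticRankOneOfRankOneFiniteShaTwo`, stmt-19080)

Third helper file of prover seat `bsd-line-spt-p1` (`--supports stmt-22356 --as helper`) for the transfer crux
T = `FiniteShaComponentTransfer` («`t_p(E) = 0 → t_q(E) = 0` for every elliptic `E/ℚ` and all primes `p, q`»,
`t_p(E) = corank_{ℤ_p} Ш(E)[p^∞] = W.shaCorank p`), after `…Slices` / `…Sectors` / `…DoorAtTwo` (g0) and
`…RankTwoDoor` / `…OrdinaryPair` / `…DoorAtThree` (g2). It kernel-checks three entries of the Edisonian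
repair census of T that were not yet in the tree:

* §1 SELMER COORDINATES. By Greenberg's identity `corank Sel_{p^∞} = rank + t_p` (tree theorem
  `selmerCorank_eq_mordellWeilRank_add_holds`), `t_p(E) = 0 ↔ corank Sel_{p^∞}(E/ℚ) = rank E(ℚ) ↔
  corank Sel_{p^∞}(E/ℚ) ≤ rank E(ℚ)`, so T is a statement about `p^∞`-SELMER CORANKS ALONE, with no `Ш` in it:
  «if `corank_{ℤ_p} Sel_{p^∞}(E/ℚ)` attains its lower bound `rank E(ℚ)` at one prime, it attains it at every
  prime» (`finiteShaComponentTransfer_iff_selmerCorank`), equivalently «`t_p(E) = 0` forces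
  `corank Sel_{q^∞}(E/ℚ) = corank Sel_{p^∞}(E/ℚ)` for every `q`» (`finiteShaComponentTransfer_iff_selmerCorank_eq`).
* §2 PARITY REPAIRS (the `p`-parity theorem, Dokchitser–Dokchitser 2010 Thm. 1.4, as a named-fact HYPOTHESIS).
  Granting `p`-parity at all primes, T is EQUIVALENT to the weaker-looking «`t_p(E) = 0 ⟹ t_q(E) ≤ 1`»
  (`finiteShaComponentTransfer_iff_le_one_of_p_parity`; in Selmer coordinates «`s_p = r ⟹ s_q ≤ r + 1`»):
  one finite primary component already forbids a SINGLE copy of `ℚ_q/ℤ_q` in `Ш(E)` at any other prime, so the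
  honest residue of T is `t_q(E) ≥ 2`. And the DOOR alone decides Mordell–Weil parity: O = `OneFiniteShaComponent`
  (stmt-22357) implies the registered crux PAR = `Squeeze.SqueezeParity` (stmt-BirchSwinnertonDyer-0146,
  «`rank E(ℚ) ≡ ord_{s=1} L(E,s) (mod 2)` for every `E/ℚ`») granting the analytic `p`-parity theorem
  (`squeezeParity_of_oneFiniteShaComponent`).
* §3 THE RANK-ONE CELL AT THE DOOR PRIME 2 IS A REGISTERED CRUX. The companion `…Sectors` lists, as open residue of
  T in algebraic rank ≤ 1, the door at `p ∈ {2, 3}` and at bad / supersingular / Eisenstein primes. For the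
  congruent number curves `E_n : y² = x³ − n²x` (CM by `ℤ[i]`, ADDITIVE at `2`) this cell is EXACTLY crux B of route
  `CongruentShaFreeCut` (stmt-BirchSwinnertonDyer-19080, `AnalyticRankOneOfRankOneFiniteShaTwo`: «`rank E_n(ℚ) = 1 ∧
  #Ш(E_n)[2^∞] < ∞ ⟹ ord_{s=1} L(E_n,s) = 1`», open; the claimed proofs Kriz 2020 / Fan–Wan 2023 are unrefereed):
  granting Burungale–Tian 2020 Thm. 1.2 (`hBT`) the route's load-bearing WEAK transfer («door prime ⟹ every good
  ordinary `q ≥ 5` of a global minimal model», the hypothesis of `ShaPrimaryTransferWeakTransfer.bsd_of_weakTransfer`)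
  — indeed already its slice «square-free `n`, `rank E_n(ℚ) = 1`: `t_2(E_n) = 0 ⟹ t_q(E_n) = 0` at the good
  ordinary primes `q ≡ 1 (mod 4)`, `q ≥ 5`, `q ∤ n`» — IMPLIES crux B (`cruxB_of_sliceTransfer`,
  `cruxB_of_weakTransfer`, `cruxB_of_finiteShaComponentTransfer`); and granting Gross–Zagier–Kolyvagin (`hGZK`)
  crux B gives back the whole transfer out of `2` for rank-one `E_n` (`shaCorank_eq_zero_of_cruxB`), so that
  crux B ⟺ the slice (`cruxB_iff_sliceTransfer`). Numbers, not adjectives: even the weak transfer, at algebraic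
  rank ONE, contains a registered open crux of difficulty XL.

Every theorem is proved over the tree; the deep inputs (`p`-parity, GZK, BT 2020) enter only as explicit
named-fact hypotheses where used. Nothing here proves T, O, crux B, PAR or BSD; T stays conjecture-grade at
rank ≥ 2.

References: R. Greenberg, LNM 1716 (1999), §1 pp. 54–57; T. and V. Dokchitser, Ann. of Math. 172 (2010),
Thm. 1.4; A. Burungale, Y. Tian, Invent. Math. 220 (2020), Thm. 1.2; V. Kolyvagin, Grothendieck Festschrift II
(1990), Thm. A / B. Gross, D. Zagier, Invent. Math. 84 (1986) (through H. Darmon, CBMS 101 (2004), Thm. 3.22);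
Y. Tian, ICM 2022 survey §3.2–3.3 (the rank-one CM `p`-converse is in print at ordinary `p` and at supersingular
`p ≥ 5` only).
-/

-- D-0017: single-problem summit, so `Summit.BirchSwinnertonDyer.BirchSwinnertonDyer.…` repeats a namespace BY DESIGN.
set_option linter.dupNamespace false

noncomputable section

namespace Summit.BirchSwinnertonDyer.BirchSwinnertonDyer.Theorems.ShaPrimaryTransferRepairCensus

open scoped Classical
open Literature.NumberTheory.EllipticCurves WeierstrassCurve
open Summit.BirchSwinnertonDyer.BirchSwinnertonDyer.Theses.ShaPrimaryTransfer
  (FiniteShaComponentTransfer OneFiniteShaComponent)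
open Summit.BirchSwinnertonDyer.BirchSwinnertonDyer.Theses.Squeeze (SqueezeParity)
open Summit.BirchSwinnertonDyer.BirchSwinnertonDyer.Theses.CongruentShaFreeCut
  (AnalyticRankOneOfRankOneFiniteShaTwo)
open Summit.BirchSwinnertonDyer.BirchSwinnertonDyer.Theorems

/-! ## §1 Selmer coordinates: T is a statement about `p^∞`-Selmer coranks alone -/

/-- `t_p(E) = 0 ↔ corank_{ℤ_p} Sel_{p^∞}(E/ℚ) = rank E(ℚ)` (Greenberg's identity
`corank Sel_{p^∞} = rank + corank Ш[p^∞]`, LNM 1716 §1, tree theorem `selmerCorank_eq_mordellWeilRank_add_holds`).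
[cite: Greenberg1999LNM, §1 pp. 54–57] -/
theorem shaCorank_eq_zero_iff_selmerCorank_eq_rank (W : WeierstrassCurve ℚ) [W.IsElliptic] (p : ℕ)
    [Fact p.Prime] : W.shaCorank p = 0 ↔ W.selmerCorank p = W.mordellWeilRank := by
  have h := W.selmerCorank_eq_mordellWeilRank_add_holds p
  omega

/-- **T in Selmer coordinates.** T ⟺ «for every elliptic `E/ℚ` and primes `p, q`: if
`corank_{ℤ_p} Sel_{p^∞}(E/ℚ) = rank E(ℚ)` then `corank_{ℤ_q} Sel_{q^∞}(E/ℚ) = rank E(ℚ)`» — the `p^∞`-Selmer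
corank attains its lower bound `rank E(ℚ)` at all primes or at none. No `Ш` occurs on the right.
[cite: Greenberg1999LNM, §1 pp. 54–57] -/
theorem finiteShaComponentTransfer_iff_selmerCorank :
    FiniteShaComponentTransfer ↔ ∀ (W : WeierstrassCurve ℚ) [W.IsElliptic] (p q : ℕ) [Fact p.Prime]
      [Fact q.Prime], W.selmerCorank p = W.mordellWeilRank → W.selmerCorank q = W.mordellWeilRank := by
  constructor
  · intro h W _ p q _ _ hp
    exact (shaCorank_eq_zero_iff_selmerCorank_eq_rank W q).1
      (h W p q ((shaCorank_eq_zero_iff_selmerCorank_eq_rank W p).2 hp))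
  · intro h W _ p q _ _ hp
    exact (shaCorank_eq_zero_iff_selmerCorank_eq_rank W q).2
      (h W p q ((shaCorank_eq_zero_iff_selmerCorank_eq_rank W p).1 hp))

/-- **T in Selmer coordinates, inequality form.** T ⟺ «`corank Sel_{p^∞}(E/ℚ) ≤ rank E(ℚ)` at one prime ⟹
at every prime» (the upper bound a complete `p`-descent certifies transfers between primes; the reverse
inequality `rank ≤ corank Sel_{p^∞}` is automatic, tree theorems `Theorems.mordellWeilRank_le_selmerCorank`,
`Theorems.shaCorank_eq_zero_iff_selmerCorank_le_mordellWeilRank`). [cite: Greenberg1999LNM, §1 pp. 54–57] -/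
theorem finiteShaComponentTransfer_iff_selmerCorank_le :
    FiniteShaComponentTransfer ↔ ∀ (W : WeierstrassCurve ℚ) [W.IsElliptic] (p q : ℕ) [Fact p.Prime]
      [Fact q.Prime], W.selmerCorank p ≤ W.mordellWeilRank → W.selmerCorank q ≤ W.mordellWeilRank := by
  constructor
  · intro h W _ p q _ _ hp
    have e1 := W.selmerCorank_eq_mordellWeilRank_add_holds p
    have e2 := W.selmerCorank_eq_mordellWeilRank_add_holds q
    have hq := h W p q (by omega)
    omega
  · intro h W _ p q _ _ hp
    have e1 := W.selmerCorank_eq_mordellWeilRank_add_holds p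
    have e2 := W.selmerCorank_eq_mordellWeilRank_add_holds q
    have hq := h W p q (by omega)
    omega

/-- **T as `p`-independence of the Selmer corank below a door.** T ⟺ «`t_p(E) = 0` forces
`corank Sel_{q^∞}(E/ℚ) = corank Sel_{p^∞}(E/ℚ)` for every prime `q`» (both sides equal `rank E(ℚ)`).
[cite: Greenberg1999LNM, §1 pp. 54–57] -/
theorem finiteShaComponentTransfer_iff_selmerCorank_eq :
    FiniteShaComponentTransfer ↔ ∀ (W : WeierstrassCurve ℚ) [W.IsElliptic] (p q : ℕ) [Fact p.Prime]
      [Fact q.Prime], W.shaCorank p = 0 → W.selmerCorank q = W.selmerCorank p := by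
  constructor
  · intro h W _ p q _ _ hp
    have hq := h W p q hp
    have e1 := W.selmerCorank_eq_mordellWeilRank_add_holds p
    have e2 := W.selmerCorank_eq_mordellWeilRank_add_holds q
    omega
  · intro h W _ p q _ _ hp
    have hq := h W p q hp
    have e1 := W.selmerCorank_eq_mordellWeilRank_add_holds p
    have e2 := W.selmerCorank_eq_mordellWeilRank_add_holds q
    omega

/-! ## §2 Parity repairs (granting the `p`-parity theorem as a named-fact hypothesis) -/

/-- **One finite component forbids a single copy of `ℚ_q/ℤ_q` elsewhere.** Granting `p`-parity at `p` and
`q` (named fact `p_parity W ·`: `(-1)^{corank Sel} = w(E)`, Dokchitser–Dokchitser 2010 Thm. 1.4): `t_p(E) = 0`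
and `t_q(E) ≤ 1` force `t_q(E) = 0` (`t_q` is even, `…Slices.even_shaCorank_of_shaCorank_eq_zero_of_p_parity`).
CONDITIONAL on `hp`, `hq`. [cite: DokchitserDokchitserAnnals2010, Thm. 1.4] -/
theorem shaCorank_eq_zero_of_le_one_of_p_parity (W : WeierstrassCurve ℚ) [W.IsElliptic] (p q : ℕ)
    [Fact p.Prime] [Fact q.Prime] (hp : p_parity W p) (hq : p_parity W q) (h0 : W.shaCorank p = 0)
    (h1 : W.shaCorank q ≤ 1) : W.shaCorank q = 0 := by
  obtain ⟨k, hk⟩ := ShaPrimaryTransferSlices.even_shaCorank_of_shaCorank_eq_zero_of_p_parity W p q hp hq h0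
  omega

/-- **Repair census, parity row: T ⟺ «`t_p(E) = 0 ⟹ t_q(E) ≤ 1`»** granting the `p`-parity theorem at
every prime (`hpar`). The weaker-looking statement on the right («one finite primary component ⟹ at most
ONE copy of `ℚ_q/ℤ_q` in `Ш(E)` at every other prime») is already all of T; the honest residue of T is
`t_q(E) ≥ 2`. CONDITIONAL on `hpar`. [cite: DokchitserDokchitserAnnals2010, Thm. 1.4] -/
theorem finiteShaComponentTransfer_iff_le_one_of_p_parity
    (hpar : ∀ (W : WeierstrassCurve ℚ) [W.IsElliptic] (p : ℕ) [Fact p.Prime], p_parity W p) :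
    FiniteShaComponentTransfer ↔ ∀ (W : WeierstrassCurve ℚ) [W.IsElliptic] (p q : ℕ) [Fact p.Prime]
      [Fact q.Prime], W.shaCorank p = 0 → W.shaCorank q ≤ 1 := by
  constructor
  · intro h W _ p q _ _ h0
    have hq := h W p q h0
    omega
  · intro h W _ p q _ _ h0
    exact shaCorank_eq_zero_of_le_one_of_p_parity W p q (hpar W p) (hpar W q) h0 (h W p q h0)

/-- **The same row in Selmer coordinates: T ⟺ «`corank Sel_{p^∞} = rank ⟹ corank Sel_{q^∞} ≤ rank + 1`»**
granting `p`-parity at every prime. CONDITIONAL on `hpar`.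
[cite: DokchitserDokchitserAnnals2010, Thm. 1.4] [cite: Greenberg1999LNM, §1 pp. 54–57] -/
theorem finiteShaComponentTransfer_iff_selmerCorank_le_rank_add_one_of_p_parity
    (hpar : ∀ (W : WeierstrassCurve ℚ) [W.IsElliptic] (p : ℕ) [Fact p.Prime], p_parity W p) :
    FiniteShaComponentTransfer ↔ ∀ (W : WeierstrassCurve ℚ) [W.IsElliptic] (p q : ℕ) [Fact p.Prime]
      [Fact q.Prime], W.selmerCorank p = W.mordellWeilRank → W.selmerCorank q ≤ W.mordellWeilRank + 1 := by
  rw [finiteShaComponentTransfer_iff_le_one_of_p_parity hpar]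
  constructor
  · intro h W _ p q _ _ hp
    have h1 := h W p q ((shaCorank_eq_zero_iff_selmerCorank_eq_rank W p).2 hp)
    have e2 := W.selmerCorank_eq_mordellWeilRank_add_holds q
    omega
  · intro h W _ p q _ _ h0
    have h1 := h W p q ((shaCorank_eq_zero_iff_selmerCorank_eq_rank W p).1 h0)
    have e2 := W.selmerCorank_eq_mordellWeilRank_add_holds q
    omega

/-- **A door decides Mordell–Weil parity for its curve.** At a prime `p` where the analytic `p`-parity
theorem holds (named fact `selmerCorank_mod_two_eq W p`: `corank Sel_{p^∞} ≡ ord_{s=1} L(E,s) (mod 2)`,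
Dokchitser–Dokchitser 2010 Thm. 1.4), `t_p(E) = 0` gives `rank E(ℚ) ≡ ord_{s=1} L(E,s) (mod 2)`.
CONDITIONAL on `hpp`. [cite: DokchitserDokchitserAnnals2010, §1 and Thm. 1.4] -/
theorem mordellWeilRank_mod_two_eq_of_door (W : WeierstrassCurve ℚ) [W.IsElliptic] (p : ℕ) [Fact p.Prime]
    (hpp : selmerCorank_mod_two_eq W p) (h0 : W.shaCorank p = 0) :
    W.mordellWeilRank % 2 = W.analyticRank % 2 := by
  have h1 : W.selmerCorank p % 2 = W.analyticRank % 2 := hpp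
  have h2 := W.selmerCorank_eq_mordellWeilRank_add_holds p
  omega

/-- **O ⟹ PAR.** The door O = `OneFiniteShaComponent` (stmt-22357: every `E/ℚ` has SOME prime `p₀` with
`t_{p₀}(E) = 0`) implies the registered crux PAR = `Squeeze.SqueezeParity` (stmt-BirchSwinnertonDyer-0146: the
Mordell–Weil parity conjecture for every `E/ℚ`), granting the analytic `p`-parity theorem at every prime
(`hpar`) — because `p`-parity reaches `rank E(ℚ)` exactly through the parity of `t_p(E)`, which a door kills.
CONDITIONAL on `hpar`. [cite: DokchitserDokchitserAnnals2010, §1 and Thm. 1.4] -/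
theorem squeezeParity_of_oneFiniteShaComponent
    (hpar : ∀ (W : WeierstrassCurve ℚ) [W.IsElliptic] (p : ℕ) [Fact p.Prime], selmerCorank_mod_two_eq W p)
    (hO : OneFiniteShaComponent) : SqueezeParity := by
  intro W _
  obtain ⟨p, hp, h0⟩ := hO W
  have h := mordellWeilRank_mod_two_eq_of_door W p (hpar W p) h0
  rw [Nat.even_iff, Nat.even_iff]
  omega

/-! ## §3 The rank-one cell at the door prime `2` is crux B of `CongruentShaFreeCut` (stmt-19080) -/

/-- **Dirichlet, for the ORDINARY primes of `E_a`**: for every `a ≠ 0` there is a prime `p ≥ 5`,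
`p ≡ 1 (mod 4)`, `p ∤ a` (Mathlib's `Nat.forall_exists_prime_gt_and_eq_mod` for the unit `1 ∈ ℤ/4`, with
`p > max a 4`). [folklore] -/
theorem exists_prime_five_le_mod_four_eq_one_not_dvd {a : ℕ} (ha : a ≠ 0) :
    ∃ p : ℕ, p.Prime ∧ 5 ≤ p ∧ p % 4 = 1 ∧ ¬ p ∣ a := by
  have h1 : IsUnit (1 : ZMod 4) := isUnit_one
  obtain ⟨p, hgt, hp, hp1⟩ := Nat.forall_exists_prime_gt_and_eq_mod h1 (max a 4)
  refine ⟨p, hp, by omega, ?_, ?_⟩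
  · have hv := congrArg ZMod.val hp1
    rw [ZMod.val_natCast] at hv
    exact hv.trans rfl
  · exact Nat.not_dvd_of_pos_of_lt (Nat.pos_of_ne_zero ha) (by omega)

/-- **The good ordinary primes of `E_n`**: for square-free `n` and a prime `p ≥ 5`, `p ≡ 1 (mod 4)`, `p ∤ n`,
the congruent number curve `E_n : y² = x³ − n²x` (its own global minimal model, `isGloballyMinimal_congruentNumberCurve`,
where `a_p` is read) has good ORDINARY reduction at `p` — good because `p ∤ 2n`
(`hasGoodReductionAtPrime_congruentNumberCurve`), ordinary by Deuring since `p` splits in the CM field `ℚ(i)`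
(`Rank1Residual.not_dvd_frobeniusTrace_of_maximal_of_cmSplit`, `CongruentShaFreeCutGoodPrimes.cmSplit_congruentNumberCurve`,
on the global minimal model `isGloballyMinimal_congruentNumberCurve`). [cite: Lang1987, Ch. 13 §4 Thm. 12] -/
theorem goodOrdinary_congruentNumberCurve {n : ℕ} (hn : Squarefree n) {p : ℕ} [Fact p.Prime] (hp : 5 ≤ p)
    (hp4 : p % 4 = 1) (hpn : ¬ p ∣ n) :
    haveI := isGloballyMinimal_congruentNumberCurve hn
    (congruentNumberCurve n).HasGoodReductionAtPrime p ∧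
      ¬ (p : ℤ) ∣ (congruentNumberCurve n).frobeniusTrace p := by
  have hpP : p.Prime := Fact.out
  haveI := isElliptic_congruentNumberCurve hn.ne_zero
  haveI := isGloballyMinimal_congruentNumberCurve hn
  have hp2n : ¬ p ∣ 2 * n := by
    intro h
    rcases hpP.dvd_mul.1 h with h2 | h2
    · have := Nat.le_of_dvd two_pos h2
      omega
    · exact hpn h2
  have hgood : (congruentNumberCurve n).HasGoodReductionAtPrime p :=
    hasGoodReductionAtPrime_congruentNumberCurve hp2n
  exact ⟨hgood, Rank1Residual.not_dvd_frobeniusTrace_of_maximal_of_cmSplit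
    (congruentNumberCurve_j_mem_maximalCMJInvariants n) (by omega) hgood
    (CongruentShaFreeCutGoodPrimes.cmSplit_congruentNumberCurve hn.ne_zero hp hp4)⟩

/-- **The slice of T that crux B needs, granted Burungale–Tian 2020 Thm. 1.2 (`hBT`), implies crux B.** If for
every square-free `n` with `rank E_n(ℚ) = 1` the door datum `t_2(E_n) = 0` transfers to `t_q(E_n) = 0` at the good
ordinary primes `q ≥ 5`, `q ≡ 1 (mod 4)`, `q ∤ n` of `E_n`, then crux B («`rank E_n(ℚ) = 1 ∧ #Ш(E_n)[2^∞] < ∞ ⟹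
ord_{s=1} L(E_n,s) = 1`», all `n ≠ 0`) holds: Dirichlet supplies such a `q`
(`exists_prime_five_le_mod_four_eq_one_not_dvd`), the rank-one ordinary CM `p`-converse at `q` is the landed column
`CongruentShaFreeCutGoodPrimes.analyticRank_eq_one_of_rank_eq_one_of_finite_sha_primary_ordinary` (via `hBT`), and
general `n ≠ 0` reduce to square-free `n` (`…SquarefreeReduction.analyticRankOneOfRankOneFiniteShaTwo_of_squarefree`).
CONDITIONAL on `hBT`. [cite: BurungaleTian2019, Thm. 1.2 (p. 214)] -/
theorem cruxB_of_sliceTransfer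
    (hBT : burungaleTian_analyticRank_eq_one_of_selmerCorank_eq_one_of_hasCM)
    (hsl : ∀ ⦃n : ℕ⦄, Squarefree n → (congruentNumberCurve n).mordellWeilRank = 1 →
      (congruentNumberCurve n).shaCorank 2 = 0 → ∀ (q : ℕ) [Fact q.Prime], 5 ≤ q → q % 4 = 1 → ¬ q ∣ n →
        (congruentNumberCurve n).shaCorank q = 0) :
    AnalyticRankOneOfRankOneFiniteShaTwo := by
  refine CongruentShaFreeCutSquarefreeReduction.analyticRankOneOfRankOneFiniteShaTwo_of_squarefree ?_
  intro n hn hrank hsha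
  haveI := isElliptic_congruentNumberCurve hn.ne_zero
  obtain ⟨q, hq, hq5, hq4, hqn⟩ := exists_prime_five_le_mod_four_eq_one_not_dvd hn.ne_zero
  haveI : Fact q.Prime := ⟨hq⟩
  have h2 : (congruentNumberCurve n).shaCorank 2 = 0 :=
    (finite_primaryComponent_sha_iff_shaCorank_eq_zero (congruentNumberCurve n) 2).1 hsha
  have hq0 : (congruentNumberCurve n).shaCorank q = 0 := hsl hn hrank h2 q hq5 hq4 hqn
  exact CongruentShaFreeCutGoodPrimes.analyticRank_eq_one_of_rank_eq_one_of_finite_sha_primary_ordinary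
    hBT hn hq5 hq4 hqn hrank
    ((finite_primaryComponent_sha_iff_shaCorank_eq_zero (congruentNumberCurve n) q).2 hq0)

/-- **The route's WEAK transfer contains the slice** (unconditionally): «door prime ⟹ every good ordinary
`q ≥ 5` of a global minimal model» (the hypothesis of `ShaPrimaryTransferWeakTransfer.bsd_of_weakTransfer`),
specialised to the global minimal models `E_n` (`n` square-free) at the door prime `2` and their good ordinary
primes (`goodOrdinary_congruentNumberCurve`); the rank hypothesis is idle. [folklore] -/
theorem sliceTransfer_of_weakTransfer
    (hTw : ∀ (W : WeierstrassCurve ℚ) [W.IsElliptic] [W.IsGloballyMinimal] (p₀ q : ℕ) [Fact p₀.Prime]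
      [Fact q.Prime], 5 ≤ q → W.HasGoodReductionAtPrime q → ¬ (q : ℤ) ∣ W.frobeniusTrace q →
      W.shaCorank p₀ = 0 → W.shaCorank q = 0) :
    ∀ ⦃n : ℕ⦄, Squarefree n → (congruentNumberCurve n).mordellWeilRank = 1 →
      (congruentNumberCurve n).shaCorank 2 = 0 → ∀ (q : ℕ) [Fact q.Prime], 5 ≤ q → q % 4 = 1 → ¬ q ∣ n →
        (congruentNumberCurve n).shaCorank q = 0 := by
  intro n hn _ h2 q _ hq5 hq4 hqn
  haveI := isElliptic_congruentNumberCurve hn.ne_zero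
  haveI := isGloballyMinimal_congruentNumberCurve hn
  obtain ⟨hgood, hord⟩ := goodOrdinary_congruentNumberCurve hn hq5 hq4 hqn
  exact hTw (congruentNumberCurve n) 2 q hq5 hgood hord h2

/-- **T contains the slice** (unconditionally; T ⟹ weak transfer ⟹ slice). [folklore] -/
theorem sliceTransfer_of_finiteShaComponentTransfer (hT : FiniteShaComponentTransfer) :
    ∀ ⦃n : ℕ⦄, Squarefree n → (congruentNumberCurve n).mordellWeilRank = 1 →
      (congruentNumberCurve n).shaCorank 2 = 0 → ∀ (q : ℕ) [Fact q.Prime], 5 ≤ q → q % 4 = 1 → ¬ q ∣ n →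
        (congruentNumberCurve n).shaCorank q = 0 :=
  sliceTransfer_of_weakTransfer (ShaPrimaryTransferWeakTransfer.weakTransfer_of_finiteShaComponentTransfer hT)

/-- **WEAK TRANSFER ⟹ crux B (stmt-19080), granting Burungale–Tian 2020 Thm. 1.2.** The load-bearing weak
transfer of route `ShaPrimaryTransfer` — at algebraic rank ONE, door prime `2` — already contains the open
Ш-primary transfer out of the additive prime `2` for the congruent number family (route `CongruentShaFreeCut`,
crux B, difficulty XL; Kriz 2020 / Fan–Wan 2023 unrefereed). CONDITIONAL on `hBT`.
[cite: BurungaleTian2019, Thm. 1.2 (p. 214)] -/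
theorem cruxB_of_weakTransfer
    (hBT : burungaleTian_analyticRank_eq_one_of_selmerCorank_eq_one_of_hasCM)
    (hTw : ∀ (W : WeierstrassCurve ℚ) [W.IsElliptic] [W.IsGloballyMinimal] (p₀ q : ℕ) [Fact p₀.Prime]
      [Fact q.Prime], 5 ≤ q → W.HasGoodReductionAtPrime q → ¬ (q : ℤ) ∣ W.frobeniusTrace q →
      W.shaCorank p₀ = 0 → W.shaCorank q = 0) :
    AnalyticRankOneOfRankOneFiniteShaTwo :=
  cruxB_of_sliceTransfer hBT (sliceTransfer_of_weakTransfer hTw)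

/-- **T ⟹ crux B (stmt-19080), granting Burungale–Tian 2020 Thm. 1.2**: the transfer crux of route
`ShaPrimaryTransfer` dominates crux B of route `CongruentShaFreeCut`. CONDITIONAL on `hBT`.
[cite: BurungaleTian2019, Thm. 1.2 (p. 214)] -/
theorem cruxB_of_finiteShaComponentTransfer
    (hBT : burungaleTian_analyticRank_eq_one_of_selmerCorank_eq_one_of_hasCM)
    (hT : FiniteShaComponentTransfer) : AnalyticRankOneOfRankOneFiniteShaTwo :=
  cruxB_of_sliceTransfer hBT (sliceTransfer_of_finiteShaComponentTransfer hT)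

/-- **Crux B gives back the whole transfer out of `2` for rank-one `E_n`, granting Gross–Zagier–Kolyvagin
(`hGZK`).** For `n ≠ 0` with `rank E_n(ℚ) = 1` and `t_2(E_n) = 0`: crux B makes `ord_{s=1} L(E_n,s) = 1`, GZK
makes `Ш(E_n)` finite (landed `CongruentShaFreeCutShaPrimaryTransfer.shaFinite_of_cruxB`), so `t_q(E_n) = 0` at
EVERY prime `q`. CONDITIONAL on `hGZK`, `hB`. [cite: Darmon2004, Thm. 3.22 (= Thm. 1.14) and §3.9] -/
theorem shaCorank_eq_zero_of_cruxB (hGZK : rank_eq_analyticRank_of_analyticRank_le_one)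
    (hB : AnalyticRankOneOfRankOneFiniteShaTwo) {n : ℕ} (hn : n ≠ 0)
    (hrank : (congruentNumberCurve n).mordellWeilRank = 1) (h2 : (congruentNumberCurve n).shaCorank 2 = 0)
    (q : ℕ) [Fact q.Prime] : (congruentNumberCurve n).shaCorank q = 0 := by
  haveI := isElliptic_congruentNumberCurve hn
  have hfin : Finite (congruentNumberCurve n).sha :=
    CongruentShaFreeCutShaPrimaryTransfer.shaFinite_of_cruxB hGZK hB hn hrank
      ((finite_primaryComponent_sha_iff_shaCorank_eq_zero (congruentNumberCurve n) 2).2 h2)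
  exact ShaPrimaryTransferSlices.shaCorank_eq_zero_of_finite_sha (congruentNumberCurve n) hfin q

/-- **THE CELL IS THE CRUX: crux B ⟺ the slice of T**, granting Gross–Zagier–Kolyvagin (`hGZK`, for ⟹) and
Burungale–Tian 2020 Thm. 1.2 (`hBT`, for ⟸): «`rank E_n(ℚ) = 1 ∧ #Ш(E_n)[2^∞] < ∞ ⟹ ord_{s=1} L(E_n,s) = 1`
for all `n ≠ 0`» is the same statement as «for square-free `n` with `rank E_n(ℚ) = 1`: `t_2(E_n) = 0 ⟹
t_q(E_n) = 0` at every good ordinary prime `q ≥ 5`, `q ≡ 1 (mod 4)`, `q ∤ n`» — the cell {CM by `ℤ[i]`, rank 1,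
door at the additive prime 2, target a good ordinary prime} of T's kernel in door coordinates.
CONDITIONAL on `hGZK`, `hBT`. [cite: Darmon2004, Thm. 3.22 (= Thm. 1.14) and §3.9]
[cite: BurungaleTian2019, Thm. 1.2 (p. 214)] -/
theorem cruxB_iff_sliceTransfer (hGZK : rank_eq_analyticRank_of_analyticRank_le_one)
    (hBT : burungaleTian_analyticRank_eq_one_of_selmerCorank_eq_one_of_hasCM) :
    AnalyticRankOneOfRankOneFiniteShaTwo ↔
      ∀ ⦃n : ℕ⦄, Squarefree n → (congruentNumberCurve n).mordellWeilRank = 1 →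
        (congruentNumberCurve n).shaCorank 2 = 0 → ∀ (q : ℕ) [Fact q.Prime], 5 ≤ q → q % 4 = 1 → ¬ q ∣ n →
          (congruentNumberCurve n).shaCorank q = 0 :=
  ⟨fun hB _ hn hrank h2 q _ _ _ _ => shaCorank_eq_zero_of_cruxB hGZK hB hn.ne_zero hrank h2 q,
    cruxB_of_sliceTransfer hBT⟩

/-- **Crux B ⟺ the full transfer out of `2` on rank-one congruent number curves**, granting `hGZK` (⟹) and `hBT`
(⟸): «for every `n ≠ 0` with `rank E_n(ℚ) = 1`: `t_2(E_n) = 0 ⟹ t_q(E_n) = 0` for EVERY prime `q`» — T verbatim,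
restricted to the family and the door prime `2`. CONDITIONAL on `hGZK`, `hBT`.
[cite: Darmon2004, Thm. 3.22 (= Thm. 1.14) and §3.9] [cite: BurungaleTian2019, Thm. 1.2 (p. 214)] -/
theorem cruxB_iff_transfer_doorTwo_rankOne (hGZK : rank_eq_analyticRank_of_analyticRank_le_one)
    (hBT : burungaleTian_analyticRank_eq_one_of_selmerCorank_eq_one_of_hasCM) :
    AnalyticRankOneOfRankOneFiniteShaTwo ↔
      ∀ ⦃n : ℕ⦄, n ≠ 0 → (congruentNumberCurve n).mordellWeilRank = 1 →
        (congruentNumberCurve n).shaCorank 2 = 0 → ∀ (q : ℕ) [Fact q.Prime],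
          (congruentNumberCurve n).shaCorank q = 0 :=
  ⟨fun hB _ hn hrank h2 q _ => shaCorank_eq_zero_of_cruxB hGZK hB hn hrank h2 q,
    fun h => cruxB_of_sliceTransfer hBT fun _ hn hrank h2 q _ _ _ _ => h hn.ne_zero hrank h2 q⟩

end Summit.BirchSwinnertonDyer.BirchSwinnertonDyer.Theorems.ShaPrimaryTransferRepairCensus
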